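import Summits.KontsevichZagierPeriods.Zeta5Search.TwoTaleOmega.OmegaBridge
import Summits.KontsevichZagierPeriods.Zeta5Search.Certificates.TwoTaleOmegaBaseTable

/-!
# (bmiss)@Ω — the BASE VALUES: the hinge forms `U1`, `U0` vanish at every base point of the Ω-induction (cell `pub-zeta5`, cert-2 gen 5)

HONEST FRAMING: systematic search; recurrence certificates; no irrationality claim unless certified. Finite algebra over `ℚ`; no named
fact, no `sorry`.

This file discharges the hypothesis `hbase` of cert-2's `TwoTaleOmegaRuleLegit.eq_on_Omega_rule` (legitimacy predicate `LegitSet CertU`: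
every rule step certified, `a`/`aef` steps for targets with `a ≥ 17`) for the kernel hinge forms `I_L := U1 ∘ ofVec`, `U0 ∘ ofVec` against
`I_R := 0`: **`U_zero_of_base`** — at every base point `U1 = U0 = 0`.  Ingredients: the base lies in the 1908-point table
(`TwoTaleOmegaBaseEnum.base_cases_table`); at the 1902 REGULAR table points (`d ≥ 0`) cert-2 g4's kernel checks `formQZ + formQTZ = 0`,
`formPZ M M + D_M²·formPTev = 0` (`TwoTaleOmegaBaseTable.regular_facts`) become `q = −q̂`, `p = −p̂` through [Zu14] Prop. 1/Prop. 3 as formalised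
(`formQ_eq_cast`, `formP_eq_cast`, `formQT_eq_cast`, `formPT_eq_ev`), i.e. `Bmiss`, i.e. `U1 = U0 = 0` (`OmegaForms.bmiss_iff`); at the 6 ODD points
(`d = −1`, outside `Zudilin2014.Admissible`) the link lemmas of `FormalBarnesLink/TLink` give directly `Π·U1 = lam1 + ε E¹/4`, `Π·U0 = lam0 + ε E⁰/2`
with `lam1[data R] = formQ`, `lam0[data R] = −formP` (`dExp = 0`), and `ε_p = signT b̂(p)` there (parity), so `U1 = U0 = 0` follows from the tree's
`formQZ = formQTZ` and the new check `formPnegEv = formPTev` (`TwoTaleOmegaBaseTable.odd_facts`) once `formQ`, `formP` are identified with their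
integer/computable mirrors WITHOUT the balance condition (`formQ_eq_cast_w`, `polyP_eq_zero_of_dneg`, `formP_eq_negEv` below — balance-free
variants of the Literature lemmas, which assume `d ≥ 0` only through the `Admissible` bundle).
-/

noncomputable section

open Finset Polynomial
open Literature.NumberTheory.Irrationality.Zudilin2014
open Summit.KontsevichZagierPeriods.Zeta5Search.FormalBarnes
open Summit.KontsevichZagierPeriods.Zeta5Search.Certificates.TwoTaleTelescope

/-! ### Balance-free casts of the first-tale forms -/

namespace Summit.KontsevichZagierPeriods.Zeta5Search.TwoTaleOmega

variable {a b : Fin 4 → ℤ}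

/-- `R₁(t) = zR1 t` at integers, balance-free (proof = `Zudilin2014.R1_eval_intCast`). -/
theorem R1_eval_intCast_w (h : AdmissibleW a b) (t : ℤ) : (R1 a b).eval (t : ℚ) = (zR1 a b t : ℚ) := by
  have h0 : b 0 ≤ a 0 := h.lower 0 (by decide) 0
  have h1 : b 1 ≤ a 1 := h.lower 1 (by decide) 1
  have h2 : b 2 ≤ a 2 := h.lower 2 (by decide) 2
  unfold R1 num numFac
  rw [eval_mul, eval_C, eval_mul, eval_mul, eval_block_intCast _ _ _ h0, eval_block_intCast _ _ _ h1,
    eval_block_intCast _ _ _ h2, zR1, facZ_eq, facZ_eq, facZ_eq]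
  push_cast
  field_simp

/-- `C_k = coefCZ k`, balance-free (proof = `Zudilin2014.coefC_eq_cast`). -/
theorem coefC_eq_cast_w (h : AdmissibleW a b) (k : ℤ) : coefC a b k = (coefCZ a b k : ℚ) := by
  unfold coefC coefCZ
  rw [eps_eq_cast, show (-(k : ℚ)) = ((-k : ℤ) : ℚ) by push_cast; ring, R1_eval_intCast_w h]
  push_cast; ring

/-- `q = formQZ`, balance-free (proof = `Zudilin2014.formQ_eq_cast`). -/
theorem formQ_eq_cast_w (h : AdmissibleW a b) : formQ a b = (formQZ a b : ℚ) := by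
  unfold formQ formQZ
  push_cast
  congr 1
  exact sum_congr rfl fun k _ => coefC_eq_cast_w h k

/-- For `d < 0` the polynomial part of `R` vanishes (degree count in `Π·num = P·den + Σ C_k·den/(X+k)`, cf. `natDegree_polyP_le_w`). -/
theorem polyP_eq_zero_of_dneg (h : AdmissibleW a b) (hd : ∑ i, a i < ∑ i, b i) : polyP a b = 0 := by
  by_contra hP
  have hid := Pi_mul_num_eq_w h
  have hdeg : (polyP a b * den a b).natDegree = (polyP a b).natDegree + (b 3 - a 3).toNat := by
    rw [natDegree_mul hP (monic_den a b).ne_zero]; unfold den; rw [natDegree_block]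
  have hPd : polyP a b * den a b = C (Pi a b) * num a b - ∑ k ∈ Ico (a 3) (b 3), C (coefC a b k) * denErase a b k := by
    rw [hid]; ring
  have h1 : (C (Pi a b) * num a b).natDegree ≤ (a 0 - b 0).toNat + (a 1 - b 1).toNat + (a 2 - b 2).toNat :=
    (natDegree_C_mul_le _ _).trans (natDegree_num a b).le
  have h2 : (∑ k ∈ Ico (a 3) (b 3), C (coefC a b k) * denErase a b k).natDegree ≤ (b 3 - a 3).toNat - 1 :=
    natDegree_sum_le_of_forall_le _ _ fun k hk => (natDegree_C_mul_le _ _).trans (natDegree_denErase_le hk)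
  have h3 := (natDegree_sub_le _ _).trans (max_le_max h1 h2)
  rw [← hPd, hdeg] at h3
  have hu := h.upper 3
  have l0 := h.lower 0 (by decide) 0
  have l1 := h.lower 1 (by decide) 1
  have l2 := h.lower 2 (by decide) 2
  simp only [Fin.sum_univ_four] at hd
  omega

/-- For `d < 0`: `dExp = 0`. -/
theorem dExp_eq_zero_of_dneg (hd : ∑ i, a i < ∑ i, b i) : dExp a b = 0 := by
  unfold dExp; omega

/-- **`p(a,b)` for `d < 0`**: no polynomial part, so `formP = Σ_k coefCZ_k · H₂(k − a₂*) = formPnegEv` (balance-free). -/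
theorem formP_eq_negEv (h : AdmissibleW a b) (hd : ∑ i, a i < ∑ i, b i) : formP a b = formPnegEv a b := by
  have hdE := dExp_eq_zero_of_dneg hd
  have hP := polyP_eq_zero_of_dneg h hd
  unfold formP formPnegEv
  rw [hdE]
  simp only [pow_zero, one_mul, zero_add, coefA, hP, eval_zero, mul_zero, sum_const_zero, zero_div, sub_zero]
  exact sum_congr rfl fun k _ => by rw [coefC_eq_cast_w h k]

/-! ### Points from table tuples -/

/-- The point of a table tuple `(a,b,e,f,g)`. -/
def ofTup (q : Tup) : Pt := ⟨q.1, q.2.1, q.2.2.1, q.2.2.2.1, q.2.2.2.2⟩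

/-- The tale data of `ofTup q` are cert-2's `tale1A/1B/2A/2B q` (definitionally). -/
theorem tales_ofTup (q : Tup) : (ofTup q).t1a = tale1A q ∧ (ofTup q).t1b = tale1B q ∧ (ofTup q).t2a = tale2A q ∧ (ofTup q).t2b = tale2B q :=
  ⟨rfl, rfl, rfl, rfl⟩

/-- `d(ofTup q) = dTup q`. -/
theorem dInt_ofTup (q : Tup) : (ofTup q).dInt = dTup q := by
  unfold Pt.dInt dTup ofTup; ring

/-! ### Regular base points: `q = −q̂`, `p = −p̂` ⇒ `U1 = U0 = 0` -/

/-- **Regular table points.** If `d ≥ 0` and cert-2 g4's two integer checks hold at `q`, then `U1 = U0 = 0` at `ofTup q`. -/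
theorem U_zero_regular {q : Tup} (hΩ : (ofTup q).Omega) (hd : 0 ≤ dTup q)
    (hq : formQZ (tale1A q) (tale1B q) + formQTZ (tale2A q) (tale2B q) = 0)
    (hp : (formPZ (tale1A q) (tale1B q) (baseM q) (baseM q) : ℚ) +
      ((Nat.lcmUpto (baseM q) : ℚ) * Nat.lcmUpto (baseM q)) * formPTev (tale2A q) (tale2B q) = 0) :
    (ofTup q).U1 = 0 ∧ (ofTup q).U0 = 0 := by
  set P := ofTup q with hPdef
  have hd' : 0 ≤ P.dInt := by rw [hPdef, dInt_ofTup]; exact hd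
  have hA : Admissible P.t1a P.t1b := hΩ.admissible hd'
  have hT : AdmissibleT P.t2a P.t2b := hΩ.admissibleT
  obtain ⟨e1a, e1b, e2a, e2b⟩ := tales_ofTup q
  rw [← hPdef] at e1a e1b e2a e2b
  rw [← e1a, ← e1b, ← e2a, ← e2b] at hq hp
  refine (P.bmiss_iff hd').1 ⟨?_, ?_⟩
  · rw [formQ_eq_cast hA, formQT_eq_cast hT]
    have : ((formQZ P.t1a P.t1b + formQTZ P.t2a P.t2b : ℤ) : ℚ) = 0 := by rw [hq]; push_cast; rfl
    push_cast at this
    linarith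
  · -- the scaling parameter and the side conditions of `formP_eq_cast`
    obtain ⟨o1, o2, o3, o4, o5, o6, o7, o8, o9⟩ := hΩ
    have hpos := Pt.Omega.pos ⟨o1, o2, o3, o4, o5, o6, o7, o8, o9⟩
    have ha2 := Pt.a2star_t1a_eq ⟨o1, o2, o3, o4, o5, o6, o7, o8, o9⟩
    have hM : baseM q = max (P.g.toNat) ((P.dInt + 1).toNat) := by
      rw [hPdef]; unfold baseM Pt.dInt ofTup; simp only; congr 2; ring
    have hdE : (dExp P.t1a P.t1b : ℤ) = P.dInt := P.dExp_eq hd'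
    have hc : ∀ j : Fin 4, j ≠ 3 → (P.t1a j - P.t1b j).toNat ≤ baseM q := by
      intro j hj
      rw [hM]
      fin_cases j <;> simp [Pt.t1a, Pt.t1b] at hj ⊢ <;> omega
    have hK : (P.t1b 3 - a2star P.t1a - 1).toNat ≤ baseM q := by
      rw [hM, ha2]; simp only [Pt.t1b, Matrix.cons_val]; omega
    have hdM : dExp P.t1a P.t1b + 1 ≤ baseM q := by rw [hM]; omega
    have hcast := formP_eq_cast hA hc hK hK hdM
    have hL : (0 : ℚ) < Nat.lcmUpto (baseM q) := by exact_mod_cast Nat.lcmUpto_pos _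
    rw [formPT_eq_ev]
    have key : ((Nat.lcmUpto (baseM q) : ℚ) * Nat.lcmUpto (baseM q)) * (formP P.t1a P.t1b + formPTev P.t2a P.t2b) = 0 := by
      rw [mul_add, hcast]; linarith
    rcases mul_eq_zero.1 key with h0 | h0
    · exact absurd h0 (by positivity)
    · linarith

/-! ### Odd base points (`d = −1`): `formQ = formQT`, `formP = formPT` ⇒ `U1 = U0 = 0` -/

/-- **Odd table points.** If `d = −1` and `formQZ = formQTZ`, `formPnegEv = formPTev` at `q`, then `U1 = U0 = 0` at `ofTup q`
(here `ε_p = signT b̂(p)`, so the sign-free combinations are `Π⁻¹(formQ − formQT)`-type differences). -/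
theorem U_zero_odd {q : Tup} (hΩ : (ofTup q).Omega) (hd : dTup q = -1)
    (hq : formQZ (tale1A q) (tale1B q) = formQTZ (tale2A q) (tale2B q))
    (hp : formPnegEv (tale1A q) (tale1B q) = formPTev (tale2A q) (tale2B q)) :
    (ofTup q).U1 = 0 ∧ (ofTup q).U0 = 0 := by
  set P := ofTup q with hPdef
  have hdI : P.dInt = -1 := by rw [hPdef, dInt_ofTup]; exact hd
  have hW : AdmissibleW P.t1a P.t1b := hΩ.admissibleW
  have hT : AdmissibleT P.t2a P.t2b := hΩ.admissibleT
  obtain ⟨e1a, e1b, e2a, e2b⟩ := tales_ofTup q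
  rw [← hPdef] at e1a e1b e2a e2b
  rw [← e1a, ← e1b, ← e2a, ← e2b] at hq hp
  have hsum : ∑ i, P.t1a i < ∑ i, P.t1b i := by have := P.sum_t1a_sub_sum_t1b; omega
  have hdE : dExp P.t1a P.t1b = 0 := dExp_eq_zero_of_dneg hsum
  -- the sign: `ε_p = signT b̂(p)` at `d = −1`
  have h2 : signT P.t2b = (-1 : ℚ) ^ (P.e + P.f + P.g) := by
    unfold signT; rw [Pt.t2b_two_add_three, Pt.neg_one_pow_natAbs]
  have h3 : P.eps = (-1 : ℚ) ^ (P.a + P.b + P.e + P.f) := Pt.neg_one_pow_natAbs _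
  have hεσ : P.eps = signT P.t2b := by
    rw [h2, h3]
    have hex : P.a + P.b + P.e + P.f = (P.e + P.f + P.g) + 2 * (P.b - P.g + 1 + (P.a + P.g - P.b - 2) / 2) := by
      have : P.a + P.g = 2 * P.e + 2 * P.f + P.b - 2 := by unfold Pt.dInt at hdI; omega
      omega
    rw [hex, zpow_add₀ (by norm_num)]
    have h1 : ((-1 : ℚ)) ^ (2 * (P.b - P.g + 1 + (P.a + P.g - P.b - 2) / 2)) = 1 := by
      rw [zpow_mul]; norm_num
    rw [h1, mul_one]
  -- values of the two functionals through the links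
  have hq1 : lam1 P.nodeL (dataR P.t1a P.t1b) = formQ P.t1a P.t1b := by
    have := link_formQ P.t1a P.t1b; rw [hdE, pow_zero, one_mul] at this; exact this
  have hq2 := link_formQT P.t2a P.t2b
  have hp1 : lam0 0 P.nodeL (dataR P.t1a P.t1b) = -formP P.t1a P.t1b := by
    have := link_formP P.t1a P.t1b; rw [hdE, pow_zero, one_mul] at this; exact this
  have hp2 := link_formPT P.t2a P.t2b
  have hQ : formQ P.t1a P.t1b = formQT P.t2a P.t2b := by
    rw [formQ_eq_cast_w hW, formQT_eq_cast hT]; exact_mod_cast hq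
  have hPf : formP P.t1a P.t1b = formPT P.t2a P.t2b := by
    rw [formP_eq_negEv hW hsum, formPT_eq_ev]; exact hp
  have hPi := P.Pi_ne_zero
  constructor
  · show lam1 P.nodeL P.vL + altE1 P.nodeR P.vR / 4 = 0
    unfold Pt.vL Pt.vR
    rw [lam1_smul, altE1_smul, hq1, hQ, hεσ]
    rw [show altE1 P.nodeR (dataRT P.t2a P.t2b) = altE1 (1 - a0star P.t2a) (dataRT P.t2a P.t2b) from rfl, hq2]
    ring
  · show lam0 (dExp P.t1a P.t1b) P.nodeL P.vL + altE0 0 P.nodeR P.vR / 2 = 0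
    unfold Pt.vL Pt.vR
    rw [hdE, lam0_smul, altE0_smul, hp1, hPf, hεσ]
    rw [show altE0 0 P.nodeR (dataRT P.t2a P.t2b) = altE0 0 (1 - a0star P.t2a) (dataRT P.t2a P.t2b) from rfl, hp2]
    ring

/-! ### The base hypothesis of the Ω-induction -/

/-- **`hbase` discharged**: at every base point of the rule legitimacy predicate with all rule steps certified (`LegitSet CertU`), the kernel hinge
forms vanish: `U1 = 0 ∧ U0 = 0`. -/
theorem U_zero_of_base {p : Certificates.TwoTaleTelescope.Pt} (h : p ∈ Base (fun δ p₀ => p₀ ∈ LegitSet CertU δ)) :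
    (ofVec p).U1 = 0 ∧ (ofVec p).U0 = 0 := by
  have e : ofVec p = ofTup (toTup p) := rfl
  have hΩ : (ofTup (toTup p)).Omega := e ▸ Omega_ofVec h.1
  rw [e]
  rcases base_cases_table h with hr | ho
  · obtain ⟨hd, hq, hp⟩ := regular_facts hr
    exact U_zero_regular hΩ hd hq hp
  · obtain ⟨hd, hq, hp⟩ := odd_facts ho
    exact U_zero_odd hΩ hd hq hp

end Summit.KontsevichZagierPeriods.Zeta5Search.TwoTaleOmega

end
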